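import Mathlib.Analysis.Convex.Function
import Literature.MathematicalPhysics.QuantumLattice.HubbardTTPrimeDiagHopTransport
import Literature.MathematicalPhysics.QuantumLattice.HubbardTTPrimeBoxWordCovering
import HarnessLib

/-!
# Conic transport of certified floors in the coupling vector `(t, t', U)`, and OUTWARD box words
# for the `t–t'` Hubbard energy density with the kinematic `t'`-constant `16/π²`

Family `hubbard` (topic `MathematicalPhysics/QuantumLattice`); written for stage S2
"certifier-families" of the Hubbard material-oracle programme (certified WORDS over parameter BOXES
`(U/t, t'/t, n)`; first object the cuprate box `(8 ± 0.5, -0.25 ± 0.05, 0.875 ± 0.01)`), seat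
`hubbard-box-p3` ("`t'`-boxes transport from the `t' ∈ {0, -1/4}` anchors; joint statements"). The object
is the thermodynamic-limit ground-state energy density `e(t, t', U, n) = energyDensityTT' t t' U n` of
`H(t,t',U) = -t T - t' T' + U D`. A *word* over a box is a certified floor / cap valid at every point of the
box. This file complements three files of the same day — `HubbardNNNHoppingEnergyDensityRegionBounds`
(joint concavity; barycentric and bilinear floors INSIDE an anchor hull; Lipschitz constant `4n` in `t'`),
`HubbardTTPrimeDiagHopTransport` (the kinematic `t'`-Lipschitz law `|Δe| ≤ (16/π²)|Δt'|` and the transport of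
`K₂`-words) and `HubbardTTPrimeBoxWordCovering` (box ⊆ grid of certified cells ⇒ box word; one anchor ⇒
rectangle with the constants `4n`, `(n/2)²`) — with the statements those do not contain:

* §1 **Conic transport** `energyDensityTT'_ge_sum_conic`: `e` is superadditive AND positively homogeneous
  in the coupling vector `(t, t', U)` on the half-space `U ≥ 0`, so certified floors
  `Lᵢ ≤ e(tᵢ, t'ᵢ, Uᵢ, n)` and ANY weights `λᵢ ≥ 0` — not normalised, `t` a genuine coordinate — give
  `Σ λᵢ Lᵢ ≤ e(Σ λᵢ tᵢ, Σ λᵢ t'ᵢ, Σ λᵢ Uᵢ, n)`. The barycentric lemma of the region-bounds file (`t` fixed,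
  `Σ λ = 1`) and every Lipschitz lemma (weight `1` at the anchor plus the free direction `(0, δ, 0)`,
  `energyDensityTT'_add_diag_le`) are faces of this one statement; so are scale (`t`-box) words.
* §2 **`t'`-transport from ANY certified diagonal-band floor** `-D|δ| ≤ e(0, δ, 0, n)`
  (`energyDensityTT'_tPrime_transport_ge_of_diagFloor`): the tree's two floors give the `min (4n) (16/π²)`
  law (`energyDensityTT'_tPrime_transport_ge_min`) and the decimal law with `1.6212 > 16/π²`
  (`energyDensityTT'_tPrime_transport_ge_decimal`); a future density-sharp floor (the free diagonal band
  at density `n`) plugs into the same slot.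
* §3 **OUTWARD box words with the kinematic constant.** One anchor ⇒ every point / every rectangle of the
  `(t', U)` half-plane (`energyDensityTT'_ge_of_anchor_kinematic`, `…_rect_ge_of_anchor_kinematic`, cap and
  window twins: the `16/π²` versions of `energyDensityTT'_rect_ge/le_of_anchor`, sharper for `n > 4/π²`,
  i.e. at every cuprate density); a floor / cap certified on a whole RECTANGLE `[s₁,s₂] × [U₁,U₂]` (bilinear
  corner floor, a cell certificate, …) ⇒ the word on any ENLARGED rectangle, losing
  `(16/π²)·max(s₁ - a₁, a₂ - s₂)` in `t'` and `(n/2)²·max(U₁ - V₁, 0)` below `U₁` (nothing above `U₂` for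
  floors; `(n/2)²·max(V₂ - U₂, 0)` for caps) — `energyDensityTT'_rect_ge_of_rectFloor_kinematic`,
  `…_rect_le_of_rectCap_kinematic`, `…_rect_ge_of_corners_kinematic`; and the one-dimensional word on a
  `t'`-interval `[a, b]` from TWO anchors `s₁ ≤ s₂` — chord inside, kinematic transport outside —
  `energyDensityTT'_tPrime_interval_ge_kinematic`:
  `min (L₁ - (16/π²)max(s₁-a,0)) (L₂ - (16/π²)max(b-s₂,0)) ≤ e` (the `t' ∈ {0, -1/4}` use case: the cuprate
  `t'`-box `[-3/10, -1/5]` from the two certified columns, `energyDensityTT'_tPrime_cuprateBox_ge`).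
* §4 **The cap side of a `t'`-interval**: two capped anchors cap `[a, b]` with loss
  `(16/π²)·max(margins, half the gap)` (`energyDensityTT'_tPrime_interval_le_kinematic`); the window
  BETWEEN two certified columns (`…_mem_Icc_between_columns_kinematic`: floor loss `0`, cap loss half
  the gap); an intermediate capped column halves the cap loss (`…_le_of_three_caps_kinematic`).
* §5 **The cell spanned by four certified columns** `[s₁,s₂] × [U₁,U₂]`: floor = smallest corner floor
  (bilinear), cap = larger upper-`U` corner cap `+ (16/π²)(s₂ - s₁)/2` (monotone in `U`, §4 along the
  upper edge) — a cell window with NO certificate solved inside the cell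
  (`energyDensityTT'_rect_mem_Icc_of_corner_windows_kinematic`, uniform form `…_of_corner_bounds_…`).
* §6 **The 3-D cell** rectangle × filling interval `[n₁, n₂]`: four filling-uniform corner floors
  (filling-box toolkit) and four upper-`U` corner caps at the two filling faces give the cell word
  (`energyDensityTT'_box₃_mem_Icc_of_corner_data_kinematic`, via `energyDensityTT'_box₃_le_max` /
  `_ge_min` of the covering file), cap loss `(16/π²)(s₂ - s₁)/2` only.

Everything is PROVED; no definition, no named fact, no numerical input. HONEST FRAMING: energy-density
transport bookkeeping for certified windows; nothing here is a statement about superconductivity.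

## Mathlib / tree search

REUSED: `energyDensityTT'_add_ge`, `energyDensityTT'_smul`, `energyDensityTT'_mono_U`,
`energyDensityTT'_ge_sub_mul_sq_U`, `energyDensityTT'_box_ge_min`, `energyDensityTT'_diag_free_ge`,
`concaveOn_energyDensityTT'_tPrime` (region / concavity files); `energyDensityTT'_sub_sixteen_div_pi_sq_mul_le`
(`HubbardTTPrimeDiagHopTransport`); `abs_sub_le_max_of_mem_Icc` (`HubbardTTPrimeBoxWordCovering`);
`neg_sixteen_mul_abs_div_pi_sq_le_energyDensityTT'_diag` (kinematic rows); Mathlib `ConcaveOn.ge_on_segment`,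
`segment_eq_Icc`, `Finset.induction_on`, `Real.pi_gt_d6`. `lean search 'sum_conic|conicComb|rectFloor|
interval_ge_kinematic|of_diagFloor'` in `Literature/`: no prior statement.

## References

* R. B. Israel, *Convexity in the Theory of Lattice Gases*, Princeton (1979), Thm. I.3.4 (the pressure
  is convex and `1`-Lipschitz in the interaction norm; its ground-state shadow is the concavity,
  superadditivity and Lipschitz continuity of `e` in the couplings). [cite: Israel1979, Thm. I.3.4]
* D. Ruelle, *Statistical Mechanics: Rigorous Results* (1969), §3.3–§3.4 (thermodynamic limit of the
  ground-state energy density). [cite: Ruelle1969, §3.3]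
* T. Koma, H. Tasaki, J. Stat. Phys. 76 (1994) 745, §1 (concavity / homogeneity of the ground-state
  energy in a coupling constant). [cite: KomaTasaki1994, §1]
* E. H. Lieb, M. Loss, Duke Math. J. 71 (1993) 337, §8 Thm. 8.2 (bathtub bound; the diagonal band
  costs at most `16|t'|/π²` per site). [cite: LiebLoss1993, §8, Theorem 8.2]
* V. Bach, E. H. Lieb, J. P. Solovej, J. Stat. Phys. 76 (1994) 3, eq. (2c.36) (Hartree–Fock states are
  variational: the slope `(n/2)²` in `U`). [cite: BachLiebSolovej1994, eq. (2c.36)]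
-/

noncomputable section

open Finset Set

namespace Literature.MathematicalPhysics.QuantumLattice

namespace ThermodynamicLimit

/-! ### §1 Conic transport: superadditivity + positive homogeneity in `(t, t', U)` -/

/-- The zero Hamiltonian has zero energy density: `e(0, 0, 0, n) = 0` (`0 ≤ n < 2`).
[cite: Ruelle1969, §3.3] -/
theorem energyDensityTT'_zero_couplings {n : ℝ} (hn0 : 0 ≤ n) (hn2 : n < 2) :
    energyDensityTT' 0 0 0 n = 0 := by
  have h := energyDensityTT'_smul 0 0 (le_refl (0 : ℝ)) hn0 hn2 (le_refl (0 : ℝ))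
  simpa using h

/-- **Conic transport (master lemma).** Certified floors `lo i ≤ e(tt i, tp i, U i, n)` at finitely
many anchors of the half-space `U ≥ 0` and ANY nonnegative weights `c i` (not normalised) give
`Σ cᵢ loᵢ ≤ e(Σ cᵢ ttᵢ, Σ cᵢ tpᵢ, Σ cᵢ Uᵢ, n)` — `e` is superadditive (`energyDensityTT'_add_ge`) and
positively homogeneous (`energyDensityTT'_smul`) in the coupling vector. [cite: Israel1979, Thm. I.3.4] -/
theorem energyDensityTT'_ge_sum_conic {n : ℝ} (hn0 : 0 ≤ n) (hn2 : n < 2) {ι : Type*}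
    (s : Finset ι) (c tt tp U lo : ι → ℝ) (hc : ∀ i ∈ s, 0 ≤ c i) (hU : ∀ i ∈ s, 0 ≤ U i)
    (hlo : ∀ i ∈ s, lo i ≤ energyDensityTT' (tt i) (tp i) (U i) n) :
    ∑ i ∈ s, c i * lo i ≤
      energyDensityTT' (∑ i ∈ s, c i * tt i) (∑ i ∈ s, c i * tp i) (∑ i ∈ s, c i * U i) n := by
  classical
  induction s using Finset.induction_on with
  | empty => simp [energyDensityTT'_zero_couplings hn0 hn2]
  | insert a s ha ih =>
    rw [Finset.sum_insert ha, Finset.sum_insert ha, Finset.sum_insert ha, Finset.sum_insert ha]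
    have hca : 0 ≤ c a := hc a (Finset.mem_insert_self a s)
    have hUa : 0 ≤ U a := hU a (Finset.mem_insert_self a s)
    have ih' := ih (fun i hi => hc i (Finset.mem_insert_of_mem hi))
      (fun i hi => hU i (Finset.mem_insert_of_mem hi))
      (fun i hi => hlo i (Finset.mem_insert_of_mem hi))
    have hsU : 0 ≤ ∑ i ∈ s, c i * U i :=
      Finset.sum_nonneg fun i hi => mul_nonneg (hc i (Finset.mem_insert_of_mem hi))
        (hU i (Finset.mem_insert_of_mem hi))
    have h1 : c a * lo a ≤ energyDensityTT' (c a * tt a) (c a * tp a) (c a * U a) n := by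
      rw [energyDensityTT'_smul (tt a) (tp a) hUa hn0 hn2 hca]
      exact mul_le_mul_of_nonneg_left (hlo a (Finset.mem_insert_self a s)) hca
    have h2 := energyDensityTT'_add_ge (c a * tt a) (∑ i ∈ s, c i * tt i) (c a * tp a)
      (∑ i ∈ s, c i * tp i) (mul_nonneg hca hUa) hsU hn0 hn2
    linarith

/-- **Conic transport, read at a prescribed target** `(t, t', U')`: the engine supplies weights with
`Σ cᵢ ttᵢ = t`, `Σ cᵢ tpᵢ = t'`, `Σ cᵢ Uᵢ = U'`. [cite: Israel1979, Thm. I.3.4] -/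
theorem energyDensityTT'_ge_sum_conic_at {n : ℝ} (hn0 : 0 ≤ n) (hn2 : n < 2) {ι : Type*}
    (s : Finset ι) (c tt tp U lo : ι → ℝ) {t t' U' : ℝ} (hc : ∀ i ∈ s, 0 ≤ c i)
    (hU : ∀ i ∈ s, 0 ≤ U i) (hlo : ∀ i ∈ s, lo i ≤ energyDensityTT' (tt i) (tp i) (U i) n)
    (ht : ∑ i ∈ s, c i * tt i = t) (ht' : ∑ i ∈ s, c i * tp i = t') (hU' : ∑ i ∈ s, c i * U i = U') :
    ∑ i ∈ s, c i * lo i ≤ energyDensityTT' t t' U' n := by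
  rw [← ht, ← ht', ← hU']
  exact energyDensityTT'_ge_sum_conic hn0 hn2 s c tt tp U lo hc hU hlo

/-- **Two-anchor conic combination**: `a, b ≥ 0` (not normalised), `U₁, U₂ ≥ 0`,
`L₁ ≤ e(t₁,s₁,U₁,n)`, `L₂ ≤ e(t₂,s₂,U₂,n)` give
`a L₁ + b L₂ ≤ e(a t₁ + b t₂, a s₁ + b s₂, a U₁ + b U₂, n)`. [cite: Israel1979, Thm. I.3.4] -/
theorem energyDensityTT'_ge_conicComb {n : ℝ} (hn0 : 0 ≤ n) (hn2 : n < 2)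
    {t₁ t₂ s₁ s₂ U₁ U₂ a b L₁ L₂ : ℝ} (hU₁ : 0 ≤ U₁) (hU₂ : 0 ≤ U₂) (ha : 0 ≤ a) (hb : 0 ≤ b)
    (hL₁ : L₁ ≤ energyDensityTT' t₁ s₁ U₁ n) (hL₂ : L₂ ≤ energyDensityTT' t₂ s₂ U₂ n) :
    a * L₁ + b * L₂ ≤
      energyDensityTT' (a * t₁ + b * t₂) (a * s₁ + b * s₂) (a * U₁ + b * U₂) n := by
  have h := energyDensityTT'_ge_sum_conic hn0 hn2 (Finset.univ : Finset (Fin 2)) ![a, b] ![t₁, t₂]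
    ![s₁, s₂] ![U₁, U₂] ![L₁, L₂] (fun i _ => by fin_cases i <;> simp [ha, hb])
    (fun i _ => by fin_cases i <;> simp [hU₁, hU₂]) (fun i _ => by fin_cases i <;> simp [hL₁, hL₂])
  simpa [Fin.sum_univ_two] using h

/-- **A free direction is an anchor**: `e(t, s, U, n) + e(0, δ, 0, n) ≤ e(t, s + δ, U, n)` (`U ≥ 0`) —
moving `t'` by `δ` costs at most the ground-state energy density of the pure diagonal band `δ T'`.
[cite: Israel1979, Thm. I.3.4] -/
theorem energyDensityTT'_add_diag_le (t s δ : ℝ) {U : ℝ} (hU : 0 ≤ U) {n : ℝ} (hn0 : 0 ≤ n)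
    (hn2 : n < 2) :
    energyDensityTT' t s U n + energyDensityTT' 0 δ 0 n ≤ energyDensityTT' t (s + δ) U n := by
  have h := energyDensityTT'_add_ge t 0 s δ hU le_rfl hn0 hn2
  rwa [add_zero, add_zero] at h

/-! ### §2 `t'`-transport from any certified diagonal-band floor -/

/-- **Transport in `t'` from any certified diagonal-band floor.** If `-D|δ| ≤ e(0, δ, 0, n)` for all
`δ`, then `e(t, s, U, n) - D|s' - s| ≤ e(t, s', U, n)` (`U ≥ 0`). The tree's floors give `D = 4n`
(`energyDensityTT'_diag_free_ge`) and `D = 16/π²` (`neg_sixteen_mul_abs_div_pi_sq_le_energyDensityTT'_diag`;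
transport law `energyDensityTT'_sub_sixteen_div_pi_sq_mul_le`); a density-sharp free-diagonal-band floor
would enter through the same slot. [cite: Israel1979, Thm. I.3.4] -/
theorem energyDensityTT'_tPrime_transport_ge_of_diagFloor (t : ℝ) {U : ℝ} (hU : 0 ≤ U) {n : ℝ}
    (hn0 : 0 ≤ n) (hn2 : n < 2) {D : ℝ} (hD : ∀ δ : ℝ, -D * |δ| ≤ energyDensityTT' 0 δ 0 n)
    (s s' : ℝ) : energyDensityTT' t s U n - D * |s' - s| ≤ energyDensityTT' t s' U n := by
  have h1 := energyDensityTT'_add_diag_le t s (s' - s) hU hn0 hn2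
  have h2 := hD (s' - s)
  rw [add_sub_cancel] at h1
  linarith

/-- **Both tree constants at once**: `-min(4n, 16/π²)·|t'| ≤ e(0, t', 0, n)` (`4n` from the operator
norm of `T'` per particle, `16/π²` from the half-filled diagonal band; `4n` wins only for `n < 4/π²`).
[cite: LiebLoss1993, §8, Theorem 8.2] -/
theorem energyDensityTT'_diag_ge_min (t' : ℝ) {n : ℝ} (hn0 : 0 ≤ n) (hn2 : n < 2) :
    -(min (4 * n) (16 / Real.pi ^ 2)) * |t'| ≤ energyDensityTT' 0 t' 0 n := by
  have h1 := energyDensityTT'_diag_free_ge t' hn0 hn2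
  have h2 := neg_sixteen_mul_abs_div_pi_sq_le_energyDensityTT'_diag t' (le_refl (0 : ℝ)) hn0 hn2
  rcases min_cases (4 * n) (16 / Real.pi ^ 2) with ⟨hmin, _⟩ | ⟨hmin, _⟩
  · rw [hmin]
    have e : -(4 * n) * |t'| = -(4 * |t'|) * n := by ring
    rwa [e]
  · rw [hmin]
    have e : -(16 / Real.pi ^ 2) * |t'| = -(16 * |t'|) / Real.pi ^ 2 := by ring
    rwa [e]

/-- **`t'`-transport, `min` form**: `e(t,s,U,n) - min(4n, 16/π²)|s' - s| ≤ e(t,s',U,n)` (`U ≥ 0`,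
`0 ≤ n < 2`). [cite: Israel1979, Thm. I.3.4] [cite: LiebLoss1993, §8, Theorem 8.2] -/
theorem energyDensityTT'_tPrime_transport_ge_min (t : ℝ) {U : ℝ} (hU : 0 ≤ U) {n : ℝ} (hn0 : 0 ≤ n)
    (hn2 : n < 2) (s s' : ℝ) :
    energyDensityTT' t s U n - min (4 * n) (16 / Real.pi ^ 2) * |s' - s| ≤
      energyDensityTT' t s' U n :=
  energyDensityTT'_tPrime_transport_ge_of_diagFloor t hU hn0 hn2
    (fun δ => energyDensityTT'_diag_ge_min δ hn0 hn2) s s'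

/-- The decimal an engine may carry: `16/π² < 1.6212`. [folklore] -/
private theorem sixteen_div_pi_sq_lt : 16 / Real.pi ^ 2 < (1.6212 : ℝ) := by
  have hπ := Real.pi_gt_d6
  have h3 : (0 : ℝ) < 3.141592 := by norm_num
  have hπ2 : (3.141592 : ℝ) ^ 2 < Real.pi ^ 2 := by nlinarith
  have hpos : (0 : ℝ) < Real.pi ^ 2 := by positivity
  rw [div_lt_iff₀ hpos]
  nlinarith

/-- **Decimal `t'`-transport**: `e(t,s,U,n) - 1.6212·|s' - s| ≤ e(t,s',U,n)` (`U ≥ 0`, `0 ≤ n < 2`;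
`1.6212 > 16/π²`). [cite: Israel1979, Thm. I.3.4] [cite: LiebLoss1993, §8, Theorem 8.2] -/
theorem energyDensityTT'_tPrime_transport_ge_decimal (t : ℝ) {U : ℝ} (hU : 0 ≤ U) {n : ℝ}
    (hn0 : 0 ≤ n) (hn2 : n < 2) (s s' : ℝ) :
    energyDensityTT' t s U n - 1.6212 * |s' - s| ≤ energyDensityTT' t s' U n := by
  have h := energyDensityTT'_sub_sixteen_div_pi_sq_mul_le t hU hn0 hn2 s s'
  have hlt := sixteen_div_pi_sq_lt
  have habs := abs_nonneg (s' - s)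
  nlinarith

/-- **Two-sided decimal form**: `|e(t,s,U,n) - e(t,s',U,n)| ≤ 1.6212·|s - s'|`.
[cite: Israel1979, Thm. I.3.4] [cite: LiebLoss1993, §8, Theorem 8.2] -/
theorem abs_energyDensityTT'_sub_tPrime_le_decimal (t : ℝ) {U : ℝ} (hU : 0 ≤ U) {n : ℝ}
    (hn0 : 0 ≤ n) (hn2 : n < 2) (s s' : ℝ) :
    |energyDensityTT' t s U n - energyDensityTT' t s' U n| ≤ 1.6212 * |s - s'| := by
  have h1 := energyDensityTT'_tPrime_transport_ge_decimal t hU hn0 hn2 s s'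
  have h2 := energyDensityTT'_tPrime_transport_ge_decimal t hU hn0 hn2 s' s
  rw [abs_sub_comm s' s] at h1
  rw [abs_le]
  constructor <;> linarith

/-! ### §3 Outward box words with the kinematic constant `16/π²` -/

/-- **One anchor floor is a floor everywhere, kinematic constant** (`U ≥ 0`): from
`L ≤ e(t, s₀, U₀, n)`, `L - (16/π²)|s - s₀| - (n/2)²·max(U₀ - U, 0) ≤ e(t, s, U, n)` — `t'` costs
`16/π²` per unit (`energyDensityTT'_sub_sixteen_div_pi_sq_mul_le`), `U` upward is free
(`energyDensityTT'_mono_U`), `U` downward costs the Hartree–Fock slope `(n/2)²`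
(`energyDensityTT'_ge_sub_mul_sq_U`). [cite: Israel1979, Thm. I.3.4] [cite: BachLiebSolovej1994, eq. (2c.36)] -/
theorem energyDensityTT'_ge_of_anchor_kinematic (t : ℝ) {n : ℝ} (hn0 : 0 ≤ n) (hn2 : n < 2)
    {s₀ U₀ L : ℝ} (hU₀ : 0 ≤ U₀) (hL : L ≤ energyDensityTT' t s₀ U₀ n) {s U : ℝ} (hU : 0 ≤ U) :
    L - 16 / Real.pi ^ 2 * |s - s₀| - (n / 2) ^ 2 * max (U₀ - U) 0 ≤ energyDensityTT' t s U n := by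
  have hU' : L - (n / 2) ^ 2 * max (U₀ - U) 0 ≤ energyDensityTT' t s₀ U n := by
    rcases le_total U U₀ with hle | hle
    · have h := energyDensityTT'_ge_sub_mul_sq_U t s₀ hn0 hn2 hU hle
      rw [max_eq_left (by linarith : (0 : ℝ) ≤ U₀ - U)]
      linarith
    · have h := energyDensityTT'_mono_U t s₀ hn0 hn2 hU₀ hle
      rw [max_eq_right (by linarith : U₀ - U ≤ 0)]
      linarith
  have h2 := energyDensityTT'_sub_sixteen_div_pi_sq_mul_le t hU hn0 hn2 s₀ s
  linarith

/-- **One anchor cap is a cap everywhere, kinematic constant** (`U, U₀ ≥ 0`): from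
`e(t, s₀, U₀, n) ≤ R`, `e(t, s, U, n) ≤ R + (16/π²)|s - s₀| + (n/2)²·max(U - U₀, 0)` — `U` downward
is free, upward costs the Hartree–Fock slope. [cite: Israel1979, Thm. I.3.4] [cite: BachLiebSolovej1994, eq. (2c.36)] -/
theorem energyDensityTT'_le_of_anchor_kinematic (t : ℝ) {n : ℝ} (hn0 : 0 ≤ n) (hn2 : n < 2)
    {s₀ U₀ R : ℝ} (hU₀ : 0 ≤ U₀) (hR : energyDensityTT' t s₀ U₀ n ≤ R) {s U : ℝ} (hU : 0 ≤ U) :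
    energyDensityTT' t s U n ≤ R + 16 / Real.pi ^ 2 * |s - s₀| + (n / 2) ^ 2 * max (U - U₀) 0 := by
  have hU' : energyDensityTT' t s₀ U n ≤ R + (n / 2) ^ 2 * max (U - U₀) 0 := by
    rcases le_total U₀ U with hle | hle
    · have h := energyDensityTT'_ge_sub_mul_sq_U t s₀ hn0 hn2 hU₀ hle
      rw [max_eq_left (by linarith : (0 : ℝ) ≤ U - U₀)]
      linarith
    · have h := energyDensityTT'_mono_U t s₀ hn0 hn2 hU hle
      rw [max_eq_right (by linarith : U - U₀ ≤ 0)]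
      linarith
  have h2 := energyDensityTT'_sub_sixteen_div_pi_sq_mul_le t hU hn0 hn2 s s₀
  rw [abs_sub_comm] at h2
  linarith

/-- **One-anchor rectangle FLOOR, kinematic constant** — the `16/π²` version of
`energyDensityTT'_rect_ge_of_anchor` (which has `4n`; `16/π² < 4n` iff `n > 4/π² ≈ 0.405`): a certified
floor `L ≤ e(t, s₀, U₀, n)` (`U₀ ≥ 0`, `0 ≤ n < 2`) is a floor on every rectangle `[s₁, s₂] × [U₁, U₂]`
(`U₁ ≥ 0`), degraded by `(16/π²)·max |s₁ − s₀| |s₂ − s₀|` and by `(n/2)²·max (U₀ − U₁) 0`.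
[cite: Israel1979, Thm. I.3.4] [cite: LiebLoss1993, §8, Theorem 8.2] -/
theorem energyDensityTT'_rect_ge_of_anchor_kinematic (t : ℝ) {n : ℝ} (hn0 : 0 ≤ n) (hn2 : n < 2)
    {s₀ U₀ L : ℝ} (hU₀ : 0 ≤ U₀) (hL : L ≤ energyDensityTT' t s₀ U₀ n) {s₁ s₂ U₁ U₂ : ℝ}
    (hU₁ : 0 ≤ U₁) {s U : ℝ} (hs₁ : s₁ ≤ s) (hs₂ : s ≤ s₂) (hU₁' : U₁ ≤ U) (_hU₂ : U ≤ U₂) :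
    L - 16 / Real.pi ^ 2 * max |s₁ - s₀| |s₂ - s₀| - (n / 2) ^ 2 * max (U₀ - U₁) 0 ≤
      energyDensityTT' t s U n := by
  have h := energyDensityTT'_ge_of_anchor_kinematic t hn0 hn2 hU₀ hL (s := s) (hU₁.trans hU₁')
  have h1 : |s - s₀| ≤ max |s₁ - s₀| |s₂ - s₀| := abs_sub_le_max_of_mem_Icc hs₁ hs₂
  have h2 : max (U₀ - U) 0 ≤ max (U₀ - U₁) 0 := max_le_max (by linarith) le_rfl
  have hκ : (0 : ℝ) ≤ 16 / Real.pi ^ 2 := by positivity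
  have hq : (0 : ℝ) ≤ (n / 2) ^ 2 := sq_nonneg _
  nlinarith [mul_le_mul_of_nonneg_left h1 hκ, mul_le_mul_of_nonneg_left h2 hq]

/-- **One-anchor rectangle CAP, kinematic constant** — the `16/π²` version of
`energyDensityTT'_rect_le_of_anchor`: a certified cap `e(t, s₀, U₀, n) ≤ R` (`U₀ ≥ 0`, `0 ≤ n < 2`) is
a cap on every rectangle `[s₁, s₂] × [U₁, U₂]` (`U₁ ≥ 0`), degraded by `(16/π²)·max |s₁ − s₀| |s₂ − s₀|`
and by `(n/2)²·max (U₂ − U₀) 0`. [cite: Israel1979, Thm. I.3.4] [cite: LiebLoss1993, §8, Theorem 8.2] -/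
theorem energyDensityTT'_rect_le_of_anchor_kinematic (t : ℝ) {n : ℝ} (hn0 : 0 ≤ n) (hn2 : n < 2)
    {s₀ U₀ R : ℝ} (hU₀ : 0 ≤ U₀) (hR : energyDensityTT' t s₀ U₀ n ≤ R) {s₁ s₂ U₁ U₂ : ℝ}
    (hU₁ : 0 ≤ U₁) {s U : ℝ} (hs₁ : s₁ ≤ s) (hs₂ : s ≤ s₂) (hU₁' : U₁ ≤ U) (hU₂ : U ≤ U₂) :
    energyDensityTT' t s U n ≤
      R + 16 / Real.pi ^ 2 * max |s₁ - s₀| |s₂ - s₀| + (n / 2) ^ 2 * max (U₂ - U₀) 0 := by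
  have h := energyDensityTT'_le_of_anchor_kinematic t hn0 hn2 hU₀ hR (s := s) (hU₁.trans hU₁')
  have h1 : |s - s₀| ≤ max |s₁ - s₀| |s₂ - s₀| := abs_sub_le_max_of_mem_Icc hs₁ hs₂
  have h2 : max (U - U₀) 0 ≤ max (U₂ - U₀) 0 := max_le_max (by linarith) le_rfl
  have hκ : (0 : ℝ) ≤ 16 / Real.pi ^ 2 := by positivity
  have hq : (0 : ℝ) ≤ (n / 2) ^ 2 := sq_nonneg _
  nlinarith [mul_le_mul_of_nonneg_left h1 hκ, mul_le_mul_of_nonneg_left h2 hq]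

/-- **One-anchor rectangle WINDOW, kinematic constant**: the certified point window `[L, R]` at
`(s₀, U₀)` read on a whole rectangle. [cite: Israel1979, Thm. I.3.4] -/
theorem energyDensityTT'_rect_mem_Icc_of_anchor_kinematic (t : ℝ) {n : ℝ} (hn0 : 0 ≤ n)
    (hn2 : n < 2) {s₀ U₀ L R : ℝ} (hU₀ : 0 ≤ U₀) (hL : L ≤ energyDensityTT' t s₀ U₀ n)
    (hR : energyDensityTT' t s₀ U₀ n ≤ R) {s₁ s₂ U₁ U₂ : ℝ} (hU₁ : 0 ≤ U₁)
    {s U : ℝ} (hs₁ : s₁ ≤ s) (hs₂ : s ≤ s₂) (hU₁' : U₁ ≤ U) (hU₂ : U ≤ U₂) :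
    energyDensityTT' t s U n ∈
      Set.Icc (L - 16 / Real.pi ^ 2 * max |s₁ - s₀| |s₂ - s₀| - (n / 2) ^ 2 * max (U₀ - U₁) 0)
        (R + 16 / Real.pi ^ 2 * max |s₁ - s₀| |s₂ - s₀| + (n / 2) ^ 2 * max (U₂ - U₀) 0) :=
  ⟨energyDensityTT'_rect_ge_of_anchor_kinematic t hn0 hn2 hU₀ hL hU₁ hs₁ hs₂ hU₁' hU₂,
    energyDensityTT'_rect_le_of_anchor_kinematic t hn0 hn2 hU₀ hR hU₁ hs₁ hs₂ hU₁' hU₂⟩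

/-- Clamping into `[s₁, s₂]` (`s₁ ≤ s₂`) lands in the interval. [folklore] -/
private theorem clamp_mem_Icc {s₁ s₂ : ℝ} (h12 : s₁ ≤ s₂) (s : ℝ) :
    max s₁ (min s s₂) ∈ Icc s₁ s₂ :=
  ⟨le_max_left _ _, max_le h12 (min_le_right _ _)⟩

/-- The distance from a point of `[a₁, a₂]` to its clamp into `[s₁, s₂]` is at most the larger margin
`max (s₁ - a₁) (a₂ - s₂)` (`a₁ ≤ s₁ ≤ s₂`; no condition on `a₂` is needed). [folklore] -/
private theorem abs_sub_clamp_le {a₁ a₂ s₁ s₂ s : ℝ} (ha : a₁ ≤ s₁) (h12 : s₁ ≤ s₂) (h₁ : a₁ ≤ s)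
    (h₂ : s ≤ a₂) : |s - max s₁ (min s s₂)| ≤ max (s₁ - a₁) (a₂ - s₂) := by
  have hm1 := le_max_left (s₁ - a₁) (a₂ - s₂)
  have hm2 := le_max_right (s₁ - a₁) (a₂ - s₂)
  rcases le_total s s₂ with hs2 | hs2
  · rw [min_eq_left hs2]
    rcases le_total s₁ s with hs1 | hs1
    · rw [max_eq_right hs1, sub_self, abs_zero]
      linarith
    · rw [max_eq_left hs1, abs_of_nonpos (by linarith : s - s₁ ≤ 0)]
      linarith
  · rw [min_eq_right hs2, max_eq_right h12, abs_of_nonneg (by linarith : 0 ≤ s - s₂)]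
    linarith

/-- The `U`-clamp into `[U₁, U₂]` costs like the lower edge: `max (clamp U - U) 0 = max (U₁ - U) 0`
(`U₁ ≤ U₂`). [folklore] -/
private theorem max_clamp_sub_eq {U₁ U₂ : ℝ} (hU12 : U₁ ≤ U₂) (U : ℝ) :
    max (max U₁ (min U U₂) - U) 0 = max (U₁ - U) 0 := by
  rcases le_total U U₂ with h2 | h2
  · rw [min_eq_left h2]
    rcases le_total U₁ U with h1 | h1
    · rw [max_eq_right h1, sub_self, max_self, max_eq_right (by linarith : U₁ - U ≤ 0)]
    · rw [max_eq_left h1]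
  · rw [min_eq_right h2, max_eq_right hU12, max_eq_right (by linarith : U₂ - U ≤ 0),
      max_eq_right (by linarith : U₁ - U ≤ 0)]

/-- The `U`-clamp costs like the upper edge for caps: `max (U - clamp U) 0 = max (U - U₂) 0`
(`U₁ ≤ U₂`). [folklore] -/
private theorem max_sub_clamp_eq {U₁ U₂ : ℝ} (hU12 : U₁ ≤ U₂) (U : ℝ) :
    max (U - max U₁ (min U U₂)) 0 = max (U - U₂) 0 := by
  rcases le_total U U₂ with h2 | h2
  · rw [min_eq_left h2, max_eq_right (by linarith : U - U₂ ≤ 0)]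
    rcases le_total U₁ U with h1 | h1
    · rw [max_eq_right h1, sub_self, max_self]
    · rw [max_eq_left h1, max_eq_right (by linarith : U - U₁ ≤ 0)]
  · rw [min_eq_right h2, max_eq_right hU12]

/-- **A rectangle floor is a floor everywhere (outward transport, kinematic constant).** If
`m ≤ e(t, s', U', n)` on the whole rectangle `[s₁, s₂] × [U₁, U₂]` of the half-plane (`0 ≤ U₁ ≤ U₂`,
`s₁ ≤ s₂`; the floor may be the bilinear corner interpolation, a cell certificate, or anything else),
then at every `(s, U)` with `U ≥ 0`: `m - (16/π²)|s - clamp(s)| - (n/2)²·max(U₁ - U, 0) ≤ e(t, s, U, n)`,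
`clamp(s) = max s₁ (min s s₂)` — transport from the nearest point of the rectangle.
[cite: Israel1979, Thm. I.3.4] [cite: BachLiebSolovej1994, eq. (2c.36)] -/
theorem energyDensityTT'_ge_of_rectFloor_kinematic (t : ℝ) {n : ℝ} (hn0 : 0 ≤ n) (hn2 : n < 2)
    {s₁ s₂ U₁ U₂ m : ℝ} (hU₁ : 0 ≤ U₁) (h12 : s₁ ≤ s₂) (hU12 : U₁ ≤ U₂)
    (hm : ∀ s' ∈ Icc s₁ s₂, ∀ U' ∈ Icc U₁ U₂, m ≤ energyDensityTT' t s' U' n) {s U : ℝ}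
    (hU : 0 ≤ U) :
    m - 16 / Real.pi ^ 2 * |s - max s₁ (min s s₂)| - (n / 2) ^ 2 * max (U₁ - U) 0 ≤
      energyDensityTT' t s U n := by
  have hL := hm _ (clamp_mem_Icc h12 s) _ (clamp_mem_Icc hU12 U)
  have hU₀ : 0 ≤ max U₁ (min U U₂) := hU₁.trans (le_max_left _ _)
  have h := energyDensityTT'_ge_of_anchor_kinematic t hn0 hn2 hU₀ hL (s := s) hU
  rwa [max_clamp_sub_eq hU12 U] at h

/-- **Outward rectangle FLOOR, kinematic constant.** A floor `m` certified on the rectangle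
`[s₁, s₂] × [U₁, U₂]` (`0 ≤ U₁ ≤ U₂`, `s₁ ≤ s₂`) is, on the ENLARGED rectangle `[a₁, a₂] × [V₁, V₂]`
(`a₁ ≤ s₁`, `0 ≤ V₁`; no condition on `a₂`, `V₂`), the floor
`m - (16/π²)·max(s₁ - a₁, a₂ - s₂) - (n/2)²·max(U₁ - V₁, 0)` — nothing is lost inside the rectangle or
above `U₂`. [cite: Israel1979, Thm. I.3.4] [cite: BachLiebSolovej1994, eq. (2c.36)] -/
theorem energyDensityTT'_rect_ge_of_rectFloor_kinematic (t : ℝ) {n : ℝ} (hn0 : 0 ≤ n) (hn2 : n < 2)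
    {s₁ s₂ U₁ U₂ m : ℝ} (hU₁ : 0 ≤ U₁) (h12 : s₁ ≤ s₂) (hU12 : U₁ ≤ U₂)
    (hm : ∀ s' ∈ Icc s₁ s₂, ∀ U' ∈ Icc U₁ U₂, m ≤ energyDensityTT' t s' U' n)
    {a₁ a₂ V₁ V₂ : ℝ} (ha₁ : a₁ ≤ s₁) (hV₁ : 0 ≤ V₁) {s U : ℝ} (hs₁ : a₁ ≤ s) (hs₂ : s ≤ a₂)
    (hV₁' : V₁ ≤ U) (_hV₂ : U ≤ V₂) :
    m - 16 / Real.pi ^ 2 * max (s₁ - a₁) (a₂ - s₂) - (n / 2) ^ 2 * max (U₁ - V₁) 0 ≤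
      energyDensityTT' t s U n := by
  have h := energyDensityTT'_ge_of_rectFloor_kinematic t hn0 hn2 hU₁ h12 hU12 hm (s := s)
    (hV₁.trans hV₁')
  have h1 := abs_sub_clamp_le ha₁ h12 hs₁ hs₂
  have h2 : max (U₁ - U) 0 ≤ max (U₁ - V₁) 0 := max_le_max (by linarith) le_rfl
  have hκ : (0 : ℝ) ≤ 16 / Real.pi ^ 2 := by positivity
  have hq : (0 : ℝ) ≤ (n / 2) ^ 2 := sq_nonneg _
  nlinarith [mul_le_mul_of_nonneg_left h1 hκ, mul_le_mul_of_nonneg_left h2 hq]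

/-- **A rectangle cap is a cap everywhere (outward transport, kinematic constant)**: if
`e(t, s', U', n) ≤ M` on `[s₁, s₂] × [U₁, U₂]` (`0 ≤ U₁ ≤ U₂`, `s₁ ≤ s₂`), then for every `U ≥ 0`:
`e(t, s, U, n) ≤ M + (16/π²)|s - clamp(s)| + (n/2)²·max(U - U₂, 0)`.
[cite: Israel1979, Thm. I.3.4] [cite: BachLiebSolovej1994, eq. (2c.36)] -/
theorem energyDensityTT'_le_of_rectCap_kinematic (t : ℝ) {n : ℝ} (hn0 : 0 ≤ n) (hn2 : n < 2)
    {s₁ s₂ U₁ U₂ M : ℝ} (hU₁ : 0 ≤ U₁) (h12 : s₁ ≤ s₂) (hU12 : U₁ ≤ U₂)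
    (hM : ∀ s' ∈ Icc s₁ s₂, ∀ U' ∈ Icc U₁ U₂, energyDensityTT' t s' U' n ≤ M) {s U : ℝ}
    (hU : 0 ≤ U) :
    energyDensityTT' t s U n ≤
      M + 16 / Real.pi ^ 2 * |s - max s₁ (min s s₂)| + (n / 2) ^ 2 * max (U - U₂) 0 := by
  have hR := hM _ (clamp_mem_Icc h12 s) _ (clamp_mem_Icc hU12 U)
  have hU₀ : 0 ≤ max U₁ (min U U₂) := hU₁.trans (le_max_left _ _)
  have h := energyDensityTT'_le_of_anchor_kinematic t hn0 hn2 hU₀ hR (s := s) hU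
  rwa [max_sub_clamp_eq hU12 U] at h

/-- **Outward rectangle CAP, kinematic constant.** A cap `M` certified on `[s₁, s₂] × [U₁, U₂]`
(`0 ≤ U₁ ≤ U₂`, `s₁ ≤ s₂`) is, on the enlarged rectangle `[a₁, a₂] × [V₁, V₂]` (`a₁ ≤ s₁`, `0 ≤ V₁`),
the cap `M + (16/π²)·max(s₁ - a₁, a₂ - s₂) + (n/2)²·max(V₂ - U₂, 0)`.
[cite: Israel1979, Thm. I.3.4] [cite: BachLiebSolovej1994, eq. (2c.36)] -/
theorem energyDensityTT'_rect_le_of_rectCap_kinematic (t : ℝ) {n : ℝ} (hn0 : 0 ≤ n) (hn2 : n < 2)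
    {s₁ s₂ U₁ U₂ M : ℝ} (hU₁ : 0 ≤ U₁) (h12 : s₁ ≤ s₂) (hU12 : U₁ ≤ U₂)
    (hM : ∀ s' ∈ Icc s₁ s₂, ∀ U' ∈ Icc U₁ U₂, energyDensityTT' t s' U' n ≤ M)
    {a₁ a₂ V₁ V₂ : ℝ} (ha₁ : a₁ ≤ s₁) (hV₁ : 0 ≤ V₁) {s U : ℝ} (hs₁ : a₁ ≤ s) (hs₂ : s ≤ a₂)
    (hV₁' : V₁ ≤ U) (hV₂ : U ≤ V₂) :
    energyDensityTT' t s U n ≤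
      M + 16 / Real.pi ^ 2 * max (s₁ - a₁) (a₂ - s₂) + (n / 2) ^ 2 * max (V₂ - U₂) 0 := by
  have h := energyDensityTT'_le_of_rectCap_kinematic t hn0 hn2 hU₁ h12 hU12 hM (s := s)
    (hV₁.trans hV₁')
  have h1 := abs_sub_clamp_le ha₁ h12 hs₁ hs₂
  have h2 : max (U - U₂) 0 ≤ max (V₂ - U₂) 0 := max_le_max (by linarith) le_rfl
  have hκ : (0 : ℝ) ≤ 16 / Real.pi ^ 2 := by positivity
  have hq : (0 : ℝ) ≤ (n / 2) ^ 2 := sq_nonneg _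
  nlinarith [mul_le_mul_of_nonneg_left h1 hκ, mul_le_mul_of_nonneg_left h2 hq]

/-- **Outward rectangle WINDOW, kinematic constant**: a window `[m, M]` certified on
`[s₁, s₂] × [U₁, U₂]` read on the enlarged rectangle `[a₁, a₂] × [V₁, V₂]` (`a₁ ≤ s₁`, `0 ≤ V₁`).
[cite: Israel1979, Thm. I.3.4] -/
theorem energyDensityTT'_rect_mem_Icc_of_rectWindow_kinematic (t : ℝ) {n : ℝ} (hn0 : 0 ≤ n)
    (hn2 : n < 2) {s₁ s₂ U₁ U₂ m M : ℝ} (hU₁ : 0 ≤ U₁) (h12 : s₁ ≤ s₂) (hU12 : U₁ ≤ U₂)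
    (hm : ∀ s' ∈ Icc s₁ s₂, ∀ U' ∈ Icc U₁ U₂, m ≤ energyDensityTT' t s' U' n)
    (hM : ∀ s' ∈ Icc s₁ s₂, ∀ U' ∈ Icc U₁ U₂, energyDensityTT' t s' U' n ≤ M)
    {a₁ a₂ V₁ V₂ : ℝ} (ha₁ : a₁ ≤ s₁) (hV₁ : 0 ≤ V₁) {s U : ℝ} (hs₁ : a₁ ≤ s) (hs₂ : s ≤ a₂)
    (hV₁' : V₁ ≤ U) (hV₂ : U ≤ V₂) :
    energyDensityTT' t s U n ∈
      Set.Icc (m - 16 / Real.pi ^ 2 * max (s₁ - a₁) (a₂ - s₂) - (n / 2) ^ 2 * max (U₁ - V₁) 0)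
        (M + 16 / Real.pi ^ 2 * max (s₁ - a₁) (a₂ - s₂) + (n / 2) ^ 2 * max (V₂ - U₂) 0) :=
  ⟨energyDensityTT'_rect_ge_of_rectFloor_kinematic t hn0 hn2 hU₁ h12 hU12 hm ha₁ hV₁ hs₁ hs₂ hV₁' hV₂,
    energyDensityTT'_rect_le_of_rectCap_kinematic t hn0 hn2 hU₁ h12 hU12 hM ha₁ hV₁ hs₁ hs₂ hV₁' hV₂⟩

/-- **Rectangle floor from the four corner floors** (the bilinear lemma `energyDensityTT'_box_ge_min`
read as a rectangle word): `min (min L₁₁ L₁₂) (min L₂₁ L₂₂) ≤ e` on `[s₁, s₂] × [U₁, U₂]`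
(`s₁ < s₂`, `0 ≤ U₁ < U₂`). [cite: Israel1979, Thm. I.3.4] -/
theorem energyDensityTT'_rect_ge_min_corners (t : ℝ) {n : ℝ} (hn0 : 0 ≤ n) (hn2 : n < 2)
    {s₁ s₂ U₁ U₂ L₁₁ L₁₂ L₂₁ L₂₂ : ℝ} (hU₁ : 0 ≤ U₁) (hs : s₁ < s₂) (hU : U₁ < U₂)
    (h₁₁ : L₁₁ ≤ energyDensityTT' t s₁ U₁ n) (h₁₂ : L₁₂ ≤ energyDensityTT' t s₁ U₂ n)
    (h₂₁ : L₂₁ ≤ energyDensityTT' t s₂ U₁ n) (h₂₂ : L₂₂ ≤ energyDensityTT' t s₂ U₂ n) :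
    ∀ s ∈ Icc s₁ s₂, ∀ U ∈ Icc U₁ U₂,
      min (min L₁₁ L₁₂) (min L₂₁ L₂₂) ≤ energyDensityTT' t s U n :=
  fun _ hs' _ hU' => energyDensityTT'_box_ge_min t hn0 hn2 hU₁ hs hU hs'.1 hs'.2 hU'.1 hU'.2
    h₁₁ h₁₂ h₂₁ h₂₂

/-- **Outward rectangle floor from four corner floors**: anchor rectangle `[s₁, s₂] × [U₁, U₂]`
(`s₁ < s₂`, `0 ≤ U₁ < U₂`) with certified corner floors, enlarged rectangle `[a₁, a₂] × [V₁, V₂]`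
(`a₁ ≤ s₁`, `0 ≤ V₁`):
`min corners - (16/π²)·max(s₁ - a₁, a₂ - s₂) - (n/2)²·max(U₁ - V₁, 0) ≤ e(t, s, U, n)` on it — the
two `t'`-columns `{-1/4, 0}` × two `U`-rows give the word on the cuprate box's `(t', U)` face.
[cite: Israel1979, Thm. I.3.4] [cite: BachLiebSolovej1994, eq. (2c.36)] -/
theorem energyDensityTT'_rect_ge_of_corners_kinematic (t : ℝ) {n : ℝ} (hn0 : 0 ≤ n) (hn2 : n < 2)
    {s₁ s₂ U₁ U₂ L₁₁ L₁₂ L₂₁ L₂₂ : ℝ} (hU₁ : 0 ≤ U₁) (hs12 : s₁ < s₂) (hU12 : U₁ < U₂)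
    (h₁₁ : L₁₁ ≤ energyDensityTT' t s₁ U₁ n) (h₁₂ : L₁₂ ≤ energyDensityTT' t s₁ U₂ n)
    (h₂₁ : L₂₁ ≤ energyDensityTT' t s₂ U₁ n) (h₂₂ : L₂₂ ≤ energyDensityTT' t s₂ U₂ n)
    {a₁ a₂ V₁ V₂ : ℝ} (ha₁ : a₁ ≤ s₁) (hV₁ : 0 ≤ V₁) {s U : ℝ} (hs₁ : a₁ ≤ s) (hs₂ : s ≤ a₂)
    (hV₁' : V₁ ≤ U) (hV₂ : U ≤ V₂) :
    min (min L₁₁ L₁₂) (min L₂₁ L₂₂) - 16 / Real.pi ^ 2 * max (s₁ - a₁) (a₂ - s₂) -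
        (n / 2) ^ 2 * max (U₁ - V₁) 0 ≤ energyDensityTT' t s U n :=
  energyDensityTT'_rect_ge_of_rectFloor_kinematic t hn0 hn2 hU₁ hs12.le hU12.le
    (energyDensityTT'_rect_ge_min_corners t hn0 hn2 hU₁ hs12 hU12 h₁₁ h₁₂ h₂₁ h₂₂) ha₁ hV₁ hs₁ hs₂
    hV₁' hV₂

/-- **The `t'`-interval word from two anchors, kinematic constant** (`t' ∈ {0, -1/4}` transporting to
a `t'`-box): for `s₁ ≤ s₂`, floors `L₁ ≤ e(t,s₁,U,n)`, `L₂ ≤ e(t,s₂,U,n)` and ANY interval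
`[a, b] ∋ s`: `min (L₁ - (16/π²)·max(s₁ - a, 0)) (L₂ - (16/π²)·max(b - s₂, 0)) ≤ e(t, s, U, n)` — inside
`[s₁, s₂]` the concave `e` is above `min(L₁, L₂)` (the chord bound `energyDensityTT'_tPrime_chord_le`
is the sharper interior reading), outside it is transported from the nearer anchor.
[cite: Israel1979, Thm. I.3.4] [cite: LiebLoss1993, §8, Theorem 8.2] -/
theorem energyDensityTT'_tPrime_interval_ge_kinematic (t : ℝ) {U : ℝ} (hU : 0 ≤ U) {n : ℝ}
    (hn0 : 0 ≤ n) (hn2 : n < 2) {s₁ s₂ L₁ L₂ : ℝ} (h12 : s₁ ≤ s₂)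
    (hL₁ : L₁ ≤ energyDensityTT' t s₁ U n) (hL₂ : L₂ ≤ energyDensityTT' t s₂ U n) {a b s : ℝ}
    (has : a ≤ s) (hsb : s ≤ b) :
    min (L₁ - 16 / Real.pi ^ 2 * max (s₁ - a) 0) (L₂ - 16 / Real.pi ^ 2 * max (b - s₂) 0) ≤
      energyDensityTT' t s U n := by
  have hκ : (0 : ℝ) ≤ 16 / Real.pi ^ 2 := by positivity
  have hA : 0 ≤ 16 / Real.pi ^ 2 * max (s₁ - a) 0 := mul_nonneg hκ (le_max_right _ _)
  have hB : 0 ≤ 16 / Real.pi ^ 2 * max (b - s₂) 0 := mul_nonneg hκ (le_max_right _ _)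
  rcases lt_or_ge s s₁ with h1 | h1
  · -- left of the anchors: transport from `s₁`
    have h := energyDensityTT'_sub_sixteen_div_pi_sq_mul_le t hU hn0 hn2 s₁ s
    have hd : |s - s₁| ≤ max (s₁ - a) 0 := by
      rw [abs_of_nonpos (by linarith : s - s₁ ≤ 0)]
      exact le_trans (by linarith) (le_max_left _ _)
    have := mul_le_mul_of_nonneg_left hd hκ
    exact (min_le_left _ _).trans (by linarith)
  rcases le_or_gt s s₂ with h2 | h2
  · -- between the anchors: concavity
    have hseg : s ∈ segment ℝ s₁ s₂ := by
      rw [segment_eq_Icc h12]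
      exact ⟨h1, h2⟩
    have hc := (concaveOn_energyDensityTT'_tPrime t hU hn0 hn2).ge_on_segment (mem_univ s₁)
      (mem_univ s₂) hseg
    have hmin : min L₁ L₂ ≤ min (energyDensityTT' t s₁ U n) (energyDensityTT' t s₂ U n) :=
      min_le_min hL₁ hL₂
    have hle : min (L₁ - 16 / Real.pi ^ 2 * max (s₁ - a) 0)
        (L₂ - 16 / Real.pi ^ 2 * max (b - s₂) 0) ≤ min L₁ L₂ :=
      min_le_min (by linarith) (by linarith)
    exact hle.trans (hmin.trans hc)
  · -- right of the anchors: transport from `s₂`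
    have h := energyDensityTT'_sub_sixteen_div_pi_sq_mul_le t hU hn0 hn2 s₂ s
    have hd : |s - s₂| ≤ max (b - s₂) 0 := by
      rw [abs_of_nonneg (by linarith : 0 ≤ s - s₂)]
      exact le_trans (by linarith) (le_max_left _ _)
    have := mul_le_mul_of_nonneg_left hd hκ
    exact (min_le_right _ _).trans (by linarith)

/-- **The cuprate `t'`-box instance shape**: floors `L₀ ≤ e(t, 0, U, n)` and `L₁ ≤ e(t, -1/4, U, n)` at
the two certified columns give, on the whole `t'`-box `[-3/10, -1/5]`,
`min (L₁ - (16/π²)/20) L₀ ≤ e(t, s, U, n)` (the column `-1/4` transported outward by `1/20`; the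
column `0` is never the far side). [cite: Israel1979, Thm. I.3.4] [cite: LiebLoss1993, §8, Theorem 8.2] -/
theorem energyDensityTT'_tPrime_cuprateBox_ge (t : ℝ) {U : ℝ} (hU : 0 ≤ U) {n : ℝ} (hn0 : 0 ≤ n)
    (hn2 : n < 2) {L₀ L₁ : ℝ} (hL₀ : L₀ ≤ energyDensityTT' t 0 U n)
    (hL₁ : L₁ ≤ energyDensityTT' t (-1 / 4) U n) {s : ℝ} (has : -3 / 10 ≤ s) (hsb : s ≤ -1 / 5) :
    min (L₁ - 16 / Real.pi ^ 2 / 20) L₀ ≤ energyDensityTT' t s U n := by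
  have h := energyDensityTT'_tPrime_interval_ge_kinematic t hU hn0 hn2 (s₁ := -1 / 4) (s₂ := 0)
    (by norm_num) hL₁ hL₀ has hsb
  have e1 : max ((-1 / 4 : ℝ) - -3 / 10) 0 = 1 / 20 := by
    rw [max_eq_left (by norm_num : (0 : ℝ) ≤ -1 / 4 - -3 / 10)]
    norm_num
  have e2 : max ((-1 / 5 : ℝ) - 0) 0 = 0 := max_eq_right (by norm_num)
  rw [e1, e2, mul_zero, sub_zero,
    show 16 / Real.pi ^ 2 * (1 / 20 : ℝ) = 16 / Real.pi ^ 2 / 20 by ring] at h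
  exact h

/-! ### §4 The cap side of a `t'`-interval: two capped columns, kinematic constant

Inside the hull of two anchors a concave function has no cap from the two anchor caps alone; the
kinematic Lipschitz law supplies one from the NEARER capped anchor, so the loss is governed by the
distance to the nearest cap — the margins outside `[s₁, s₂]` and HALF the gap inside it. -/

/-- On `[a, b]`, the distance to the nearer of two points `s₁, s₂` is at most
`max (max (s₁ - a) (b - s₂)) ((s₂ - s₁)/2)` (no order hypothesis is needed). [folklore] -/
private theorem min_abs_sub_le {a b s₁ s₂ s : ℝ} (has : a ≤ s) (hsb : s ≤ b) :
    min |s - s₁| |s - s₂| ≤ max (max (s₁ - a) (b - s₂)) ((s₂ - s₁) / 2) := by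
  have hm1 : s₁ - a ≤ max (max (s₁ - a) (b - s₂)) ((s₂ - s₁) / 2) :=
    (le_max_left _ _).trans (le_max_left _ _)
  have hm2 : b - s₂ ≤ max (max (s₁ - a) (b - s₂)) ((s₂ - s₁) / 2) :=
    (le_max_right _ _).trans (le_max_left _ _)
  have hm3 : (s₂ - s₁) / 2 ≤ max (max (s₁ - a) (b - s₂)) ((s₂ - s₁) / 2) := le_max_right _ _
  rcases le_or_gt s s₁ with h1 | h1
  · rw [abs_of_nonpos (by linarith : s - s₁ ≤ 0)]
    exact (min_le_left _ _).trans (by linarith)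
  rcases le_or_gt s₂ s with h2 | h2
  · rw [abs_of_nonneg (by linarith : 0 ≤ s - s₂)]
    exact (min_le_right _ _).trans (by linarith)
  · -- strictly between: the nearer anchor is within half the gap
    rw [abs_of_nonneg (by linarith : 0 ≤ s - s₁), abs_of_nonpos (by linarith : s - s₂ ≤ 0)]
    rcases le_or_gt (s - s₁) ((s₂ - s₁) / 2) with h3 | h3
    · exact (min_le_left _ _).trans (h3.trans hm3)
    · exact (min_le_right _ _).trans (le_trans (by linarith) hm3)

/-- **The `t'`-interval CAP word from two capped anchors, kinematic constant**: for anchors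
`s₁, s₂` (in practice `s₁ ≤ s₂`; no order hypothesis is needed), caps `e(t,s₁,U,n) ≤ R₁`, `e(t,s₂,U,n) ≤ R₂` and any interval `[a, b] ∋ s`:
`e(t, s, U, n) ≤ max R₁ R₂ + (16/π²)·max (max (s₁ - a) (b - s₂)) ((s₂ - s₁)/2)` — transport from the
nearer capped anchor; inside the hull the loss is half the gap (two caps alone do not bound a concave
function from above between them), outside it is the margin. This is the cap twin of
`energyDensityTT'_tPrime_interval_ge_kinematic`; an intermediate capped column halves the interior
loss. [cite: Israel1979, Thm. I.3.4] [cite: LiebLoss1993, §8, Theorem 8.2] -/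
theorem energyDensityTT'_tPrime_interval_le_kinematic (t : ℝ) {U : ℝ} (hU : 0 ≤ U) {n : ℝ}
    (hn0 : 0 ≤ n) (hn2 : n < 2) {s₁ s₂ R₁ R₂ : ℝ}
    (hR₁ : energyDensityTT' t s₁ U n ≤ R₁) (hR₂ : energyDensityTT' t s₂ U n ≤ R₂) {a b s : ℝ}
    (has : a ≤ s) (hsb : s ≤ b) :
    energyDensityTT' t s U n ≤
      max R₁ R₂ + 16 / Real.pi ^ 2 * max (max (s₁ - a) (b - s₂)) ((s₂ - s₁) / 2) := by
  have hκ : (0 : ℝ) ≤ 16 / Real.pi ^ 2 := by positivity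
  have hd := min_abs_sub_le (s₁ := s₁) (s₂ := s₂) has hsb
  have h1 := energyDensityTT'_le_of_upperBound_tPrime_kinematic t hU hn0 hn2 (s' := s) hR₁
  have h2 := energyDensityTT'_le_of_upperBound_tPrime_kinematic t hU hn0 hn2 (s' := s) hR₂
  have hR1 := le_max_left R₁ R₂
  have hR2 := le_max_right R₁ R₂
  rcases min_cases |s - s₁| |s - s₂| with ⟨hmin, _⟩ | ⟨hmin, _⟩
  · rw [hmin] at hd
    have := mul_le_mul_of_nonneg_left hd hκ
    linarith
  · rw [hmin] at hd
    have := mul_le_mul_of_nonneg_left hd hκ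
    linarith

/-- **The window BETWEEN two certified columns** (`s₁ ≤ s₂`, windows `[L₁, R₁]`, `[L₂, R₂]`): on
`[s₁, s₂]`, `min L₁ L₂ ≤ e(t, s, U, n) ≤ max R₁ R₂ + (16/π²)(s₂ - s₁)/2` — the floor side is free
(concavity), the cap side pays half the gap at the kinematic constant (the hole-doped-cuprate columns
`t' ∈ {-1/4, 0}` word every `t'`-box inside `[-1/4, 0]`, e.g. an LSCO-class box `[-1/5, -1/10]`, with
floor loss `0` and cap loss `(16/π²)/8 ≈ 0.2026`). [cite: Israel1979, Thm. I.3.4] [cite: LiebLoss1993, §8, Theorem 8.2] -/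
theorem energyDensityTT'_tPrime_mem_Icc_between_columns_kinematic (t : ℝ) {U : ℝ} (hU : 0 ≤ U)
    {n : ℝ} (hn0 : 0 ≤ n) (hn2 : n < 2) {s₁ s₂ L₁ R₁ L₂ R₂ : ℝ} (h12 : s₁ ≤ s₂)
    (hL₁ : L₁ ≤ energyDensityTT' t s₁ U n) (hR₁ : energyDensityTT' t s₁ U n ≤ R₁)
    (hL₂ : L₂ ≤ energyDensityTT' t s₂ U n) (hR₂ : energyDensityTT' t s₂ U n ≤ R₂) {s : ℝ}
    (h₁ : s₁ ≤ s) (h₂ : s ≤ s₂) :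
    energyDensityTT' t s U n ∈
      Set.Icc (min L₁ L₂) (max R₁ R₂ + 16 / Real.pi ^ 2 * ((s₂ - s₁) / 2)) := by
  refine ⟨?_, ?_⟩
  · have h := energyDensityTT'_tPrime_interval_ge_kinematic t hU hn0 hn2 h12 hL₁ hL₂ h₁ h₂
    rwa [sub_self, sub_self, max_eq_right (le_refl (0 : ℝ)), mul_zero, sub_zero, sub_zero] at h
  · have h := energyDensityTT'_tPrime_interval_le_kinematic t hU hn0 hn2 hR₁ hR₂ h₁ h₂
    rwa [sub_self, sub_self, max_eq_right (le_refl (0 : ℝ)),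
      max_eq_right (by linarith : (0 : ℝ) ≤ (s₂ - s₁) / 2)] at h

/-- **A capped column INSIDE the box halves the cap loss**: caps `R₁` at `s₁`, `R_m` at an
intermediate `s_m` (meant in `[s₁, s₂]`; no order hypothesis is needed) and `R₂` at `s₂`: on `[s₁, s₂]`,
`e ≤ max (max R₁ R_m) R₂ + (16/π²)·max ((s_m - s₁)/2) ((s₂ - s_m)/2)` (the cure for `t'`-boxes inside
the column hull: one variational upper at the box centre). [cite: Israel1979, Thm. I.3.4] -/
theorem energyDensityTT'_tPrime_le_of_three_caps_kinematic (t : ℝ) {U : ℝ} (hU : 0 ≤ U) {n : ℝ}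
    (hn0 : 0 ≤ n) (hn2 : n < 2) {s₁ sₘ s₂ R₁ Rₘ R₂ : ℝ}
    (hR₁ : energyDensityTT' t s₁ U n ≤ R₁) (hRₘ : energyDensityTT' t sₘ U n ≤ Rₘ)
    (hR₂ : energyDensityTT' t s₂ U n ≤ R₂) {s : ℝ} (h₁ : s₁ ≤ s) (h₂ : s ≤ s₂) :
    energyDensityTT' t s U n ≤
      max (max R₁ Rₘ) R₂ + 16 / Real.pi ^ 2 * max ((sₘ - s₁) / 2) ((s₂ - sₘ) / 2) := by
  have hκ : (0 : ℝ) ≤ 16 / Real.pi ^ 2 := by positivity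
  rcases le_total s sₘ with hs | hs
  · -- left sub-box `[s₁, sₘ]`
    have h := energyDensityTT'_tPrime_interval_le_kinematic t hU hn0 hn2 hR₁ hRₘ h₁ hs
    rw [sub_self, sub_self, max_eq_right (le_refl (0 : ℝ)),
      max_eq_right (by linarith : (0 : ℝ) ≤ (sₘ - s₁) / 2)] at h
    have hA : max R₁ Rₘ ≤ max (max R₁ Rₘ) R₂ := le_max_left _ _
    have hB := mul_le_mul_of_nonneg_left (le_max_left ((sₘ - s₁) / 2) ((s₂ - sₘ) / 2)) hκ
    linarith
  · -- right sub-box `[sₘ, s₂]`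
    have h := energyDensityTT'_tPrime_interval_le_kinematic t hU hn0 hn2 hRₘ hR₂ hs h₂
    rw [sub_self, sub_self, max_eq_right (le_refl (0 : ℝ)),
      max_eq_right (by linarith : (0 : ℝ) ≤ (s₂ - sₘ) / 2)] at h
    have hA : max Rₘ R₂ ≤ max (max R₁ Rₘ) R₂ := max_le ((le_max_right _ _).trans (le_max_left _ _))
      (le_max_right _ _)
    have hB := mul_le_mul_of_nonneg_left (le_max_right ((sₘ - s₁) / 2) ((s₂ - sₘ) / 2)) hκ
    linarith

/-! ### §5 The rectangle spanned by four certified columns: a cell window WITHOUT a cell certificate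

For a rectangle `[s₁, s₂] × [U₁, U₂]` of the `(t', U)` half-plane whose four corners carry certified
energy windows, the FLOOR on the whole rectangle is the smallest corner floor (bilinear interpolation of
the jointly concave `e`, `energyDensityTT'_box_ge_min`) and the CAP is transported from the two UPPER-`U`
corners only: `U ↦ e` is non-decreasing (`energyDensityTT'_mono_U`), so the cap at `U₂` serves every
`U ≤ U₂`, and along `t'` at `U = U₂` the two capped corners pay half the gap (§4). -/

/-- **Rectangle CAP from the two upper-`U` corner caps**: caps `R₁₂` at `(s₁, U₂)`, `R₂₂` at `(s₂, U₂)`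
(`U₂ ≥ 0`) give `e(t, s, U, n) ≤ max R₁₂ R₂₂ + (16/π²)(s₂ - s₁)/2` for `s₁ ≤ s ≤ s₂`, `0 ≤ U ≤ U₂`
(monotone in `U`, then §4 along the upper edge). [cite: Israel1979, Thm. I.3.4] [cite: KomaTasaki1994, §1] -/
theorem energyDensityTT'_rect_le_of_upper_corner_caps_kinematic (t : ℝ) {n : ℝ} (hn0 : 0 ≤ n)
    (hn2 : n < 2) {s₁ s₂ U₂ R₁₂ R₂₂ : ℝ} (hU₂ : 0 ≤ U₂)
    (hR₁₂ : energyDensityTT' t s₁ U₂ n ≤ R₁₂) (hR₂₂ : energyDensityTT' t s₂ U₂ n ≤ R₂₂) {s U : ℝ}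
    (h₁ : s₁ ≤ s) (h₂ : s ≤ s₂) (hU : 0 ≤ U) (hUU₂ : U ≤ U₂) :
    energyDensityTT' t s U n ≤ max R₁₂ R₂₂ + 16 / Real.pi ^ 2 * ((s₂ - s₁) / 2) := by
  have hmono := energyDensityTT'_mono_U t s hn0 hn2 hU hUU₂
  have h := energyDensityTT'_tPrime_interval_le_kinematic t hU₂ hn0 hn2 hR₁₂ hR₂₂ h₁ h₂
  rw [sub_self, sub_self, max_eq_right (le_refl (0 : ℝ)),
    max_eq_right (by linarith : (0 : ℝ) ≤ (s₂ - s₁) / 2)] at h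
  exact hmono.trans h

/-- **The cell window spanned by four certified columns** (`s₁ < s₂`, `0 ≤ U₁ < U₂`): corner floors
`L₁₁, L₁₂, L₂₁, L₂₂` at `(s₁,U₁), (s₁,U₂), (s₂,U₁), (s₂,U₂)` and the two upper-`U` corner caps
`R₁₂, R₂₂` give, at every point of `[s₁, s₂] × [U₁, U₂]`,
`e ∈ [min (min L₁₁ L₁₂) (min L₂₁ L₂₂), max R₁₂ R₂₂ + (16/π²)(s₂ - s₁)/2]` — floor loss `0` relative to
the worst corner, cap loss half the `t'`-gap at the kinematic constant, `U`-extent free. (The lower-`U`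
corner caps are not needed; the atlas's column pairs `t' ∈ {-1/4, 0}` × consecutive `U` rows word every
such cell with no certificate solved inside it.) [cite: Israel1979, Thm. I.3.4] [cite: KomaTasaki1994, §1] -/
theorem energyDensityTT'_rect_mem_Icc_of_corner_windows_kinematic (t : ℝ) {n : ℝ} (hn0 : 0 ≤ n)
    (hn2 : n < 2) {s₁ s₂ U₁ U₂ L₁₁ L₁₂ L₂₁ L₂₂ R₁₂ R₂₂ : ℝ} (hU₁ : 0 ≤ U₁) (hs : s₁ < s₂)
    (hU : U₁ < U₂) (h₁₁ : L₁₁ ≤ energyDensityTT' t s₁ U₁ n) (h₁₂ : L₁₂ ≤ energyDensityTT' t s₁ U₂ n)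
    (h₂₁ : L₂₁ ≤ energyDensityTT' t s₂ U₁ n) (h₂₂ : L₂₂ ≤ energyDensityTT' t s₂ U₂ n)
    (hR₁₂ : energyDensityTT' t s₁ U₂ n ≤ R₁₂) (hR₂₂ : energyDensityTT' t s₂ U₂ n ≤ R₂₂) {s U : ℝ}
    (hs₁ : s₁ ≤ s) (hs₂ : s ≤ s₂) (hU₁' : U₁ ≤ U) (hU₂ : U ≤ U₂) :
    energyDensityTT' t s U n ∈
      Set.Icc (min (min L₁₁ L₁₂) (min L₂₁ L₂₂)) (max R₁₂ R₂₂ + 16 / Real.pi ^ 2 * ((s₂ - s₁) / 2)) :=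
  ⟨energyDensityTT'_box_ge_min t hn0 hn2 hU₁ hs hU hs₁ hs₂ hU₁' hU₂ h₁₁ h₁₂ h₂₁ h₂₂,
    energyDensityTT'_rect_le_of_upper_corner_caps_kinematic t hn0 hn2 (hU₁.trans hU.le) hR₁₂ hR₂₂
      hs₁ hs₂ (hU₁.trans hU₁') hU₂⟩

/-- **Uniform form of the four-column cell word**: if all four corner floors are `≥ m` and both
upper-`U` corner caps are `≤ M`, the cell `[s₁, s₂] × [U₁, U₂]` carries the window
`[m, M + (16/π²)(s₂ - s₁)/2]` (so the cell word is at most `(16/π²)(s₂ - s₁)/2` wider than the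
envelope `[m, M]` of the corner words). [cite: Israel1979, Thm. I.3.4] -/
theorem energyDensityTT'_rect_mem_Icc_of_corner_bounds_kinematic (t : ℝ) {n : ℝ} (hn0 : 0 ≤ n)
    (hn2 : n < 2) {s₁ s₂ U₁ U₂ m M : ℝ} (hU₁ : 0 ≤ U₁) (hs : s₁ < s₂) (hU : U₁ < U₂)
    (h₁₁ : m ≤ energyDensityTT' t s₁ U₁ n) (h₁₂ : m ≤ energyDensityTT' t s₁ U₂ n)
    (h₂₁ : m ≤ energyDensityTT' t s₂ U₁ n) (h₂₂ : m ≤ energyDensityTT' t s₂ U₂ n)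
    (hR₁₂ : energyDensityTT' t s₁ U₂ n ≤ M) (hR₂₂ : energyDensityTT' t s₂ U₂ n ≤ M) {s U : ℝ}
    (hs₁ : s₁ ≤ s) (hs₂ : s ≤ s₂) (hU₁' : U₁ ≤ U) (hU₂ : U ≤ U₂) :
    energyDensityTT' t s U n ∈ Set.Icc m (M + 16 / Real.pi ^ 2 * ((s₂ - s₁) / 2)) := by
  have h := energyDensityTT'_rect_mem_Icc_of_corner_windows_kinematic t hn0 hn2 hU₁ hs hU h₁₁ h₁₂
    h₂₁ h₂₂ hR₁₂ hR₂₂ hs₁ hs₂ hU₁' hU₂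
  simp only [min_self, max_self] at h
  exact h

/-! ### §6 The 3-D cell spanned by certified columns: `(t', U)`-rectangle × filling interval

Convexity in the density makes the CAP of a filling interval the larger endpoint cap
(`energyDensityTT'_box₃_le_max` of `HubbardTTPrimeBoxWordCovering`); feeding it the §5 rectangle caps
(two upper-`U` corners at each filling endpoint) gives the 3-D cell cap from FOUR corner caps, and with
the four filling-uniform corner floors of `energyDensityTT'_box₃_ge_min` (the filling-box toolkit's
output per corner) the whole 3-D cell word — no certificate solved inside the cell, cap loss
`(16/π²)(s₂ - s₁)/2` only. -/

/-- **3-D cell CAP from the four upper-`U` corner caps, kinematic constant**: caps at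
`(s₁, U₂), (s₂, U₂)` for the filling endpoints `n₁` (`R₁, R₂`) and `n₂` (`R₁', R₂'`), `0 ≤ U₁ ≤ U₂`,
`0 ≤ n₁`, `n₂ < 2`: on `[s₁, s₂] × [U₁, U₂] × [n₁, n₂]`,
`e ≤ max (max R₁ R₂) (max R₁' R₂') + (16/π²)(s₂ - s₁)/2`. [cite: Israel1979, Thm. I.3.4] [cite: Ruelle1969, §3.3] -/
theorem energyDensityTT'_box₃_le_of_upper_corner_caps_kinematic (t : ℝ) {s₁ s₂ U₁ U₂ n₁ n₂ : ℝ}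
    (hU₁ : 0 ≤ U₁) (hU12 : U₁ ≤ U₂) (hn₁ : 0 ≤ n₁) (hn₂ : n₂ < 2) {R₁ R₂ R₁' R₂' : ℝ}
    (hR₁ : energyDensityTT' t s₁ U₂ n₁ ≤ R₁) (hR₂ : energyDensityTT' t s₂ U₂ n₁ ≤ R₂)
    (hR₁' : energyDensityTT' t s₁ U₂ n₂ ≤ R₁') (hR₂' : energyDensityTT' t s₂ U₂ n₂ ≤ R₂')
    {s U n : ℝ} (hs₁ : s₁ ≤ s) (hs₂ : s ≤ s₂) (hU₁' : U₁ ≤ U) (hU₂ : U ≤ U₂)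
    (hn : n ∈ Set.Icc n₁ n₂) :
    energyDensityTT' t s U n ≤ max (max R₁ R₂) (max R₁' R₂') + 16 / Real.pi ^ 2 * ((s₂ - s₁) / 2) := by
  have hU₂0 : 0 ≤ U₂ := hU₁.trans hU12
  have hn₁2 : n₁ < 2 := lt_of_le_of_lt (hn.1.trans hn.2) hn₂
  have hn₂0 : 0 ≤ n₂ := hn₁.trans (hn.1.trans hn.2)
  have h := energyDensityTT'_box₃_le_max t hU₁ hn₁ hn₂
    (C₁ := max R₁ R₂ + 16 / Real.pi ^ 2 * ((s₂ - s₁) / 2))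
    (C₂ := max R₁' R₂' + 16 / Real.pi ^ 2 * ((s₂ - s₁) / 2))
    (fun s' U' h1 h2 h3 h4 => energyDensityTT'_rect_le_of_upper_corner_caps_kinematic t hn₁ hn₁2 hU₂0
      hR₁ hR₂ h1 h2 (hU₁.trans h3) h4)
    (fun s' U' h1 h2 h3 h4 => energyDensityTT'_rect_le_of_upper_corner_caps_kinematic t hn₂0 hn₂ hU₂0
      hR₁' hR₂' h1 h2 (hU₁.trans h3) h4)
    hs₁ hs₂ hU₁' hU₂ hn
  rwa [max_add_add_right] at h

/-- **The 3-D cell WORD spanned by certified columns**: rectangle `[s₁, s₂] × [U₁, U₂]` (`s₁ < s₂`,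
`0 ≤ U₁ < U₂`) × filling interval `[n₁, n₂]` (`0 ≤ n₁`, `n₂ < 2`); four corner floors UNIFORM over the
filling interval (the filling-box toolkit's per-corner output) and four caps at the upper-`U` corners of
the two filling faces: at every point of the cell,
`e ∈ [min corner floors, max (max R₁ R₂) (max R₁' R₂') + (16/π²)(s₂ - s₁)/2]`.
[cite: Israel1979, Thm. I.3.4] [cite: Ruelle1969, §3.3] -/
theorem energyDensityTT'_box₃_mem_Icc_of_corner_data_kinematic (t : ℝ) {s₁ s₂ U₁ U₂ n₁ n₂ : ℝ}
    (hU₁ : 0 ≤ U₁) (hs : s₁ < s₂) (hU : U₁ < U₂) (hn₁ : 0 ≤ n₁) (hn₂ : n₂ < 2)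
    {L₁₁ L₁₂ L₂₁ L₂₂ R₁ R₂ R₁' R₂' : ℝ}
    (h₁₁ : ∀ n ∈ Set.Icc n₁ n₂, L₁₁ ≤ energyDensityTT' t s₁ U₁ n)
    (h₁₂ : ∀ n ∈ Set.Icc n₁ n₂, L₁₂ ≤ energyDensityTT' t s₁ U₂ n)
    (h₂₁ : ∀ n ∈ Set.Icc n₁ n₂, L₂₁ ≤ energyDensityTT' t s₂ U₁ n)
    (h₂₂ : ∀ n ∈ Set.Icc n₁ n₂, L₂₂ ≤ energyDensityTT' t s₂ U₂ n)
    (hR₁ : energyDensityTT' t s₁ U₂ n₁ ≤ R₁) (hR₂ : energyDensityTT' t s₂ U₂ n₁ ≤ R₂)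
    (hR₁' : energyDensityTT' t s₁ U₂ n₂ ≤ R₁') (hR₂' : energyDensityTT' t s₂ U₂ n₂ ≤ R₂')
    {s U n : ℝ} (hs₁ : s₁ ≤ s) (hs₂ : s ≤ s₂) (hU₁' : U₁ ≤ U) (hU₂ : U ≤ U₂)
    (hn : n ∈ Set.Icc n₁ n₂) :
    energyDensityTT' t s U n ∈
      Set.Icc (min (min L₁₁ L₁₂) (min L₂₁ L₂₂))
        (max (max R₁ R₂) (max R₁' R₂') + 16 / Real.pi ^ 2 * ((s₂ - s₁) / 2)) :=
  ⟨energyDensityTT'_box₃_ge_min t hU₁ hs hU hn₁ hn₂ h₁₁ h₁₂ h₂₁ h₂₂ hs₁ hs₂ hU₁' hU₂ hn,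
    energyDensityTT'_box₃_le_of_upper_corner_caps_kinematic t hU₁ hU.le hn₁ hn₂ hR₁ hR₂ hR₁' hR₂'
      hs₁ hs₂ hU₁' hU₂ hn⟩

end ThermodynamicLimit

end Literature.MathematicalPhysics.QuantumLattice

end
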